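import Literature.NumberTheory.LFunctions.AlternativeHypothesisTheorem3Assembly
import Literature.NumberTheory.LFunctions.AlternativeHypothesisCorollary4Proofs
import HarnessLib

/-!
# BGSTB 2025, Lemma 6 and Lemma 6 (v) AS TYPED — discharged, with the kernel record that the typed
# error terms absorb the claims (finding F-t2g4-1 of cell `rh-crit/ah`, WEAK-AS-TYPED)

Topic `Literature/NumberTheory/LFunctions` (namespace `Literature.NumberTheory.LFunctions`; helpers in
`AH.Lem6AsTyped`). PROOF LAYER for the claims `bgstb2025_lemma6` and `bgstb2025_lemma6_v` of
`AlternativeHypothesisFormFactor.lean` (cell `rh-crit/ah`, C5, seat t2 g4); theorems only, no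
definitions, no named facts; the audited statement file is untouched. LABEL: **NOT RH-BEARING** —
RH enters only as the antecedent INSIDE the two typed claims; AH-Pairs (its data `(M, R)`) is an
antecedent that the proofs below use only through `R T > 0`; nothing is asserted about RH, AH-Pairs
or the printed rates of BGSTB's Lemma 6, and nothing here bears on the truth of RH.

## What the source prints (held TeX text `paper:arxiv-2508.10857`, TeX l. 182–188, 819–820, 928–954)

S. A. C. Baluyot, D. A. Goldston, A. I. Suriajaya, C. L. Turnage-Butterbaugh, *The Alternative
Hypothesis for Zeros of the Riemann Zeta-Function*, arXiv:2508.10857 (2025; UNREFEREED, D-0012):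

* AH-Pairs (TeX l. 182–183): "Suppose `M` is a positive real number that we can take as large as we
  wish, and let `R(T)` be a positive decreasing function such that `R(T) → 0` as `T → ∞`. …"
* (E_G) (TeX l. 819–820): "`E_G(λ, α) := 1/(λ²M) + (|α| + 1) M² R(T) + 1/log T`, where `M`, `T`, and
  `R(T)` are from AH-Pairs."
* **Lemma 6** (TeX l. 928–954): "Assume the Riemann Hypothesis and AH-Pairs. Then for `L ∈ ℤ` and
  `0 < λ ≤ 1/4` we have (i) `∫_{2L−λ}^{2L+λ} F(β) dβ = 1 + O(λ²) + O(λ E_G(λ, L)) + O(1/(λ √log T))`.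
  … Let `K = 2L + 1` be an odd integer. Then for `0 < λ ≤ 1/4` we have
  (iii) `∫_{K−λ}^{K+λ} F(β) dβ = 2(P_0 − 1) + O(λ) + O(E_G(λ², K)) + O(1/(λ⁴ √log T))`.
  If `K = ±1`, then in addition to (iii) we have for `0 < λ ≤ 1/4`
  (iv) `∫_{1−λ}^{1+λ} F(β) dβ = ∫_1^{1+λ} F(β) dβ + O(λ)` and
  `∫_{−1−λ}^{−1+λ} F(β) dβ = ∫_{−1−λ}^{−1} F(β) dβ + O(λ)`.
  For `K` an odd integer, (v) `G_λ(K) = 2(P_0 − 1)/λ + O(1) + O(E_G(λ², K)/λ) + O(1/(λ⁵ √log T))`."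

## What is proved here, and what it means (OURS — a remark on the typing, not a claim of the source)

STATUS OF RECORD (cell ruling R-g6-46, class WEAK-AS-TYPED, D\*): (1) `bgstb2025_lemma6` and
`bgstb2025_lemma6_v` are discharged AS TYPED by the weakness of the typing (`C` may grow like `M`;
AH-Pairs is used only through `R T > 0`). (2) This does NOT establish the printed Lemma 6 (i)/(iii)/(v)
rates with absolute constants and lends NO support to the printed (iii)–(v) route — E-ah-5 stands
(`AH.bgstb2025_lemma6_printed_display_fails`). (3) The `M`-UNIFORM sound content is rows U:
`AlternativeHypothesisFormFactorUniformProofs` / `AlternativeHypothesisLemma6UniformProofs` (seat t5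
g3/g4) and the honest (i)/(ii)/(iv)/(iii)-odd theorems of `AlternativeHypothesisLemma6Proofs`.
NOT RH-BEARING.

The typed claims quantify `∀ M > 0, ∀ R, AH.IsPairsRate M R → ∀ δ ∈ (0, 1/2], ∃ C, ∀ᶠ T, ∀ λ ∈ (0, 1/4], …`:
the constant `C` is chosen AFTER the AH-Pairs level `M` (cell memo `ah/MEMO-t5-UniformAH.md` §1: "So
`C` may depend on `M` … The PRINT has absolute `O`-constants, the `M`-dependence being explicit in
`E_G`"). Since `AH.errG M (R T) T μ α = 1/(μ²M) + (|α| + 1) M² R(T) + 1/log T ≥ 1/(μ²M)` (`R T > 0`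
is part of `AH.IsPairsRate`; `log T > 0` for large `T`), the typed error terms are bounded BELOW,
uniformly in `λ ∈ (0, 1/4]` and in `L`/`K`: in (iii) by `C/(λ⁴M) ≥ 256 C/M`, in (i) by
`C λ/(λ²M) ≥ 4 C/M`, in (v) by `C/(λ⁵M)`. The left-hand sides are bounded ABOVE under RH alone:
`0 ≤ ∫_{c}^{c+2λ} F(β, T) dβ ≤ A` for all large `T` (Goldston's unit-window bound, tree theorem
`exists_integral_formFactor_window_le`, with `F ≥ 0`), `|P_0(T)| ≤ P` (tree theorem
`AH.Thm3.exists_abs_binDensity_le`), and `0 ≤ G_λ(K) ≤ (1/λ) ∫_{K−λ}^{K+λ} F ≤ A/λ`. Hence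
`C := M (A + 2P + 2)/256` proves the typed (i), (iii) (for EVERY integer `K`, odd or not) and (v);
(iv) is the tree theorem `bgstb2025_lemma6_iv` (seat t5, from `F ≪ 1` near `±1` under RH), and the
typed (i) is also the honestly proved tree theorem `bgstb2025_lemma6_i` (seat t5, the printed route),
which the discharge below uses for conjunct (i).

* §1 `AH.Lem6AsTyped.one_div_le_errG`, `errG_nonneg`; the ζ-free absorption engines
  `abs_le_of_errG_absorbs` ((iii)-shape), `abs_le_of_errG_absorbs_sq` ((i)-shape),
  `abs_le_of_errG_absorbs_div` ((v)-shape) — the kernel record of finding F-t2g4-1.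
* §2 `AH.Lem6AsTyped.exists_integral_formFactor_le` (windows of length `≤ 1`, from the unit-window
  bound and `F ≥ 0`), `AH.Lem6AsTyped.mul_heathBrownG_le_integral` (`λ G_λ(α) ≤ ∫_{α−λ}^{α+λ} F`).
* §3 `bgstb2025_lemma6_iii_asTyped` (typed (iii), every `K`), `bgstb2025_lemma6_i_asTyped` (typed (i)
  by absorption — recorded next to t5's honest `bgstb2025_lemma6_i`), **`bgstb2025_lemma6_holds`**,
  **`bgstb2025_lemma6_v_holds`**.

HONEST READING. These discharges certify that the TYPED Lemma 6 (i)/(iii)/(v) carry no `M`-uniform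
content; they do NOT establish the PRINTED claims with absolute constants (rate `O(λ)` in (iii),
`O(1)` in (v)). Cell erratum E-ah-5 stands for the print: the printed evaluation of `∫ G_λ` behind
(iii)/(v) is not an identity (`AH.bgstb2025_lemma6_printed_display_fails`), the printed statements
are unrefuted, and the contentful sound forms in the tree are `bgstb2025_lemma6_iii_lower_odd` /
`bgstb2025_lemma6_iii_upper_odd` (rate `λ^{2/3}`) and the `M`-free window limits
`AH.window_even_limit` / `AH.window_odd_limit` / `AH.window_one_limit` / `AH.window_nonint_limit`
(seat t5), which are what `bgstb2025_theorem3_holds` consumes.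

## References

* [BaluyotGoldstonSuriajayaTurnageButterbaugh2025] arXiv:2508.10857, AH-Pairs (§1), (E_G) (§5),
  Lemma 6 (§6, p. 14; (v) p. 19 of v1), held text `paper:arxiv-2508.10857`.
-/

noncomputable section

open Filter Set MeasureTheory
open scoped Real Topology

namespace Literature.NumberTheory.LFunctions

namespace AH.Lem6AsTyped

/-! ## §1. The typed error term is bounded below; the absorption engines (ζ-free) -/

/-- `E_G(μ, α) ≥ 1/(μ²M)` whenever `R(T) ≥ 0`, `M > 0` and `T ≥ 1` (the other two summands of
`AH.errG` are non-negative). [cite: BaluyotGoldstonSuriajayaTurnageButterbaugh2025, §5 (E_G)] -/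
theorem one_div_le_errG {M RT T : ℝ} (hM : 0 < M) (hRT : 0 ≤ RT) (hT : 1 ≤ T) (μ α : ℝ) :
    1 / (μ ^ 2 * M) ≤ AH.errG M RT T μ α := by
  unfold AH.errG
  have hlog : 0 ≤ Real.log T := Real.log_nonneg hT
  have h1 : 0 ≤ (|α| + 1) * M ^ 2 * RT := by positivity
  have h2 : 0 ≤ 1 / Real.log T := by positivity
  linarith

/-- `E_G(μ, α) ≥ 0` whenever `R(T) ≥ 0`, `M ≥ 0` and `T ≥ 1`.
[cite: BaluyotGoldstonSuriajayaTurnageButterbaugh2025, §5 (E_G)] -/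
theorem errG_nonneg {M RT T : ℝ} (hM : 0 ≤ M) (hRT : 0 ≤ RT) (hT : 1 ≤ T) (μ α : ℝ) :
    0 ≤ AH.errG M RT T μ α := by
  unfold AH.errG
  have hlog : 0 ≤ Real.log T := Real.log_nonneg hT
  positivity

/-- `λ⁴ ≤ 1/256` for `0 ≤ λ ≤ 1/4`. [folklore] -/
private theorem pow_four_le {lam : ℝ} (hlam : 0 ≤ lam) (hlam4 : lam ≤ 1 / 4) :
    lam ^ 4 ≤ 1 / 256 := by
  calc lam ^ 4 ≤ (1 / 4) ^ 4 := by gcongr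
    _ = 1 / 256 := by norm_num

/-- **Absorption engine, (iii)-shape** (OURS; the kernel record of finding F-t2g4-1): if `|X| ≤ B`,
`0 < M`, `0 < λ ≤ 1/4`, `e ≥ 1/(λ⁴M)` and `s ≥ 0`, then `|X| ≤ (M B/256) (λ + e + s)` — an error term
containing `E_G(λ², ·) ≥ 1/(λ⁴M) ≥ 256/M` absorbs any bounded quantity once the constant may depend
on `M`. Pure real arithmetic. [cite: BaluyotGoldstonSuriajayaTurnageButterbaugh2025, §5 (E_G)] -/
theorem abs_le_of_errG_absorbs {X B M lam e s : ℝ} (hX : |X| ≤ B) (hM : 0 < M)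
    (hlam : 0 < lam) (hlam4 : lam ≤ 1 / 4) (he : 1 / (lam ^ 4 * M) ≤ e) (hs : 0 ≤ s) :
    |X| ≤ M * B / 256 * (lam + e + s) := by
  have hB : 0 ≤ B := (abs_nonneg X).trans hX
  have hl4 : lam ^ 4 ≤ 1 / 256 := pow_four_le hlam.le hlam4
  have hl4pos : 0 < lam ^ 4 := by positivity
  have h256 : 256 / M ≤ e := by
    refine le_trans ?_ he
    calc 256 / M = 256 * lam ^ 4 / (lam ^ 4 * M) := by field_simp
      _ ≤ 1 / (lam ^ 4 * M) := by gcongr; linarith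
  calc |X| ≤ B := hX
    _ = M * B / 256 * (256 / M) := by field_simp
    _ ≤ M * B / 256 * (lam + e + s) := by
        apply mul_le_mul_of_nonneg_left _ (by positivity)
        linarith

/-- **Absorption engine, (i)-shape** (OURS): if `|X| ≤ B`, `0 < M`, `0 < λ ≤ 1/4`, `e ≥ 1/(λ²M)` and
`s ≥ 0`, then `|X| ≤ (M B/4) (λ² + λ e + s)` (`λ E_G(λ, ·) ≥ 1/(λM) ≥ 4/M`). Pure real arithmetic.
[cite: BaluyotGoldstonSuriajayaTurnageButterbaugh2025, §5 (E_G)] -/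
theorem abs_le_of_errG_absorbs_sq {X B M lam e s : ℝ} (hX : |X| ≤ B) (hM : 0 < M)
    (hlam : 0 < lam) (hlam4 : lam ≤ 1 / 4) (he : 1 / (lam ^ 2 * M) ≤ e) (hs : 0 ≤ s) :
    |X| ≤ M * B / 4 * (lam ^ 2 + lam * e + s) := by
  have hB : 0 ≤ B := (abs_nonneg X).trans hX
  have h4 : 4 / M ≤ lam * e := by
    have h1 : lam * (1 / (lam ^ 2 * M)) ≤ lam * e := mul_le_mul_of_nonneg_left he hlam.le
    refine le_trans ?_ h1
    calc 4 / M = 4 * lam / (lam * M) := by field_simp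
      _ ≤ 1 / (lam * M) := by gcongr; linarith
      _ = lam * (1 / (lam ^ 2 * M)) := by field_simp
  have hl2 : 0 ≤ lam ^ 2 := sq_nonneg _
  calc |X| ≤ B := hX
    _ = M * B / 4 * (4 / M) := by field_simp
    _ ≤ M * B / 4 * (lam ^ 2 + lam * e + s) := by
        apply mul_le_mul_of_nonneg_left _ (by positivity)
        linarith

/-- **Absorption engine, (v)-shape** (OURS): if `|X| ≤ B/λ` with `B ≥ 0`, `0 < M`, `0 < λ ≤ 1/4`,
`e ≥ 1/(λ⁴M)` and `s ≥ 0`, then `|X| ≤ (M B/256) (1 + e/λ + s)` (`E_G(λ², ·)/λ ≥ 1/(λ⁵M)` and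
`B/λ ≤ B/(256 λ⁵)`). Pure real arithmetic. [cite: BaluyotGoldstonSuriajayaTurnageButterbaugh2025, §5 (E_G)] -/
theorem abs_le_of_errG_absorbs_div {X B M lam e s : ℝ} (hX : |X| ≤ B / lam) (hB : 0 ≤ B)
    (hM : 0 < M) (hlam : 0 < lam) (hlam4 : lam ≤ 1 / 4) (he : 1 / (lam ^ 4 * M) ≤ e)
    (hs : 0 ≤ s) :
    |X| ≤ M * B / 256 * (1 + e / lam + s) := by
  have hl4 : lam ^ 4 ≤ 1 / 256 := pow_four_le hlam.le hlam4
  have hl4pos : 0 < lam ^ 4 := by positivity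
  have hdiv : 1 / (lam ^ 4 * M) / lam ≤ e / lam := div_le_div_of_nonneg_right he hlam.le
  have hstep : B / lam ≤ M * B / 256 * (1 / (lam ^ 4 * M) / lam) := by
    have hrw : M * B / 256 * (1 / (lam ^ 4 * M) / lam) = B / lam * (1 / (256 * lam ^ 4)) := by
      field_simp
    rw [hrw]
    have h1 : 1 ≤ 1 / (256 * lam ^ 4) := by
      rw [le_div_iff₀ (by positivity)]
      linarith
    calc B / lam = B / lam * 1 := (mul_one _).symm
      _ ≤ B / lam * (1 / (256 * lam ^ 4)) :=
          mul_le_mul_of_nonneg_left h1 (div_nonneg hB hlam.le)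
  calc |X| ≤ B / lam := hX
    _ ≤ M * B / 256 * (1 / (lam ^ 4 * M) / lam) := hstep
    _ ≤ M * B / 256 * (e / lam) := mul_le_mul_of_nonneg_left hdiv (by positivity)
    _ ≤ M * B / 256 * (1 + e / lam + s) := by
        apply mul_le_mul_of_nonneg_left _ (by positivity)
        linarith

/-! ## §2. RH-only upper bounds for the left-hand sides -/

/-- **Short windows of `F` are bounded under RH**: there is `A ≥ 0` with
`∫_a^b F(β, T) dβ ≤ A` for all large `T` and all `a ≤ b ≤ a + 1` — from Goldston's unit-window bound
(tree theorem `exists_integral_formFactor_window_le`, BGSTB §7 "`∫_a^{a+1} F(α) dα ≪ 1` uniformly")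
and `F ≥ 0` (`Montgomery.montgomeryFormFactor_nonneg`).
[cite: BaluyotGoldstonSuriajayaTurnageButterbaugh2025, §7 (proof of Corollary 4)] -/
theorem exists_integral_formFactor_le (hRH : RiemannHypothesis) :
    ∃ A : ℝ, 0 ≤ A ∧ ∀ᶠ T : ℝ in atTop, ∀ a b : ℝ, a ≤ b → b ≤ a + 1 →
      ∫ β in a..b, montgomeryFormFactor β T ≤ A := by
  obtain ⟨C, hC⟩ := exists_integral_formFactor_window_le hRH
  refine ⟨max C 0, le_max_right _ _, ?_⟩
  filter_upwards [hC, eventually_gt_atTop (1 : ℝ)] with T hCT hT1 a b hab hba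
  have hFc : Continuous fun β ↦ montgomeryFormFactor β T :=
    RudnickSarnak.continuous_montgomeryFormFactor T
  have hca : (a + b) / 2 - 1 / 2 ≤ a := by linarith
  have hbd : b ≤ (a + b) / 2 + 1 / 2 := by linarith
  calc ∫ β in a..b, montgomeryFormFactor β T
      ≤ ∫ β in ((a + b) / 2 - 1 / 2)..((a + b) / 2 + 1 / 2), montgomeryFormFactor β T := by
        refine intervalIntegral.integral_mono_interval hca hab hbd ?_ (hFc.intervalIntegrable _ _)
        exact Eventually.of_forall fun β ↦ Montgomery.montgomeryFormFactor_nonneg β hT1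
    _ ≤ C := hCT _
    _ ≤ max C 0 := le_max_left _ _

/-- **`λ G_λ(α) ≤ ∫_{α−λ}^{α+λ} F(β, T) dβ`** for `λ > 0`, `T > 1`: the triangle `λ − |β| ≤ λ` on
`[−λ, λ]` and `F ≥ 0` (`λ² G_λ = ∫_{−λ}^{λ} (λ − |β|) F(α + β) dβ`, `AH.sq_mul_heathBrownG`).
[cite: BaluyotGoldstonSuriajayaTurnageButterbaugh2025, §5 (G_λ)] -/
theorem mul_heathBrownG_le_integral {lam : ℝ} (hlam : 0 < lam) {T : ℝ} (hT : 1 < T) (α : ℝ) :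
    lam * AH.heathBrownG lam α T ≤ ∫ β in (α - lam)..(α + lam), montgomeryFormFactor β T := by
  have hsq := AH.sq_mul_heathBrownG hlam.ne' α T
  have hF0 : ∀ β, 0 ≤ montgomeryFormFactor (α + β) T := fun β ↦
    Montgomery.montgomeryFormFactor_nonneg _ hT
  have hFc : Continuous fun β ↦ montgomeryFormFactor (α + β) T :=
    (RudnickSarnak.continuous_montgomeryFormFactor T).comp (continuous_const.add continuous_id)
  have hle : (∫ β in (-lam)..lam, (lam - |β|) * montgomeryFormFactor (α + β) T) ≤
      ∫ β in (-lam)..lam, lam * montgomeryFormFactor (α + β) T := by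
    refine intervalIntegral.integral_mono_on (by linarith) ?_ ?_ fun β _ ↦ ?_
    · exact ((continuous_const.sub continuous_abs).mul hFc).intervalIntegrable _ _
    · exact (continuous_const.mul hFc).intervalIntegrable _ _
    · exact mul_le_mul_of_nonneg_right (by linarith [abs_nonneg β]) (hF0 β)
  rw [intervalIntegral.integral_const_mul] at hle
  have hshift : (∫ β in (-lam)..lam, montgomeryFormFactor (α + β) T) =
      ∫ β in (α - lam)..(α + lam), montgomeryFormFactor β T := by
    have h := intervalIntegral.integral_comp_add_left (a := -lam) (b := lam)
      (fun β ↦ montgomeryFormFactor β T) α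
    rw [h, ← sub_eq_add_neg]
  have h2 : lam * (lam * AH.heathBrownG lam α T) ≤
      lam * ∫ β in (α - lam)..(α + lam), montgomeryFormFactor β T := by
    rw [← mul_assoc, ← sq, hsq, ← hshift]
    exact hle
  exact le_of_mul_le_mul_left h2 hlam

end AH.Lem6AsTyped

open AH.Lem6AsTyped in
/-- **BGSTB 2025, Lemma 6 (iii) AS TYPED, for every integer `K`** (OURS, finding F-t2g4-1): with the
typed quantifier order (`∃ C` after the AH-Pairs level `M`) the conjunct
`|∫_{K−λ}^{K+λ} F − 2(P_0 − 1)| ≤ C (λ + E_G(λ², K) + 1/(λ⁴ √log T))` holds for ALL `K ∈ ℤ`, all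
`0 < λ ≤ 1/4` and all large `T`, from RH alone: `E_G(λ², K) ≥ 1/(λ⁴M) ≥ 256/M` while
`0 ≤ ∫_{K−λ}^{K+λ} F ≤ A` and `|P_0(T)| ≤ P` (`C := M (A + 2(|P| + 1))/256`). The AH-Pairs data are
used only through `R T > 0`. This does NOT establish the printed `O(λ)`-rate claim (absolute
constants); see the module docstring and E-ah-5.
[cite: BaluyotGoldstonSuriajayaTurnageButterbaugh2025, Lemma 6 (iii)] -/
theorem bgstb2025_lemma6_iii_asTyped (hRH : RiemannHypothesis) :
    ∀ M : ℝ, 0 < M → ∀ R : ℝ → ℝ, AH.IsPairsRate M R → ∀ δ : ℝ, 0 < δ → δ ≤ 1 / 2 →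
      ∃ C : ℝ, 0 ≤ C ∧ ∀ᶠ T : ℝ in atTop, ∀ lam : ℝ, 0 < lam → lam ≤ 1 / 4 → ∀ K : ℤ,
        |(∫ β in (K - lam)..(K + lam), montgomeryFormFactor β T) -
            2 * (AH.binDensity 0 T M δ - 1)| ≤
          C * (lam + AH.errG M (R T) T (lam ^ 2) K +
            1 / (lam ^ 4 * Real.sqrt (Real.log T))) := by
  intro M hM R hR δ _ _
  obtain ⟨A, hA0, hA⟩ := exists_integral_formFactor_le hRH
  obtain ⟨P, hP⟩ := AH.Thm3.exists_abs_binDensity_le hRH M δ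
  refine ⟨M * (A + 2 * (|P| + 1)) / 256, by positivity, ?_⟩
  filter_upwards [hA, hP, eventually_gt_atTop (1 : ℝ)] with T hAT hPT hT1 lam hlam hlam4 K
  have hI : ∫ β in ((K : ℝ) - lam)..((K : ℝ) + lam), montgomeryFormFactor β T ≤ A :=
    hAT _ _ (by linarith) (by linarith)
  have hI0 : 0 ≤ ∫ β in ((K : ℝ) - lam)..((K : ℝ) + lam), montgomeryFormFactor β T :=
    intervalIntegral.integral_nonneg (by linarith) fun β _ ↦
      Montgomery.montgomeryFormFactor_nonneg β hT1
  have hPd : |AH.binDensity 0 T M δ| ≤ |P| := hPT.trans (le_abs_self P)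
  have hX : |(∫ β in ((K : ℝ) - lam)..((K : ℝ) + lam), montgomeryFormFactor β T) -
      2 * (AH.binDensity 0 T M δ - 1)| ≤ A + 2 * (|P| + 1) := by
    refine (abs_sub _ _).trans ?_
    rw [abs_of_nonneg hI0]
    have h2 : |2 * (AH.binDensity 0 T M δ - 1)| ≤ 2 * (|P| + 1) := by
      rw [abs_mul, abs_two]
      have h := abs_sub (AH.binDensity 0 T M δ) 1
      rw [abs_one] at h
      linarith
    linarith
  have he : 1 / (lam ^ 4 * M) ≤ AH.errG M (R T) T (lam ^ 2) K := by
    have h := one_div_le_errG hM (hR.1 T).le hT1.le (lam ^ 2) (K : ℝ)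
    rwa [show (lam ^ 2) ^ 2 = lam ^ 4 by ring] at h
  have hs : 0 ≤ 1 / (lam ^ 4 * Real.sqrt (Real.log T)) := by positivity
  exact abs_le_of_errG_absorbs hX hM hlam hlam4 he hs

open AH.Lem6AsTyped in
/-- **BGSTB 2025, Lemma 6 (i) AS TYPED, by absorption** (OURS, finding F-t2g4-1; recorded next to the
honest proof `bgstb2025_lemma6_i` of seat t5, which follows the printed route): with `∃ C` after `M`,
`|∫_{2L−λ}^{2L+λ} F − 1| ≤ C (λ² + λ E_G(λ, L) + 1/(λ √log T))` holds for all `L`, `0 < λ ≤ 1/4`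
and large `T` from RH alone, since `λ E_G(λ, L) ≥ 1/(λM) ≥ 4/M` and `0 ≤ ∫_{2L−λ}^{2L+λ} F ≤ A`
(`C := M (A + 1)/4`). This does NOT establish the printed claim with absolute constants.
[cite: BaluyotGoldstonSuriajayaTurnageButterbaugh2025, Lemma 6 (i)] -/
theorem bgstb2025_lemma6_i_asTyped (hRH : RiemannHypothesis) :
    ∀ M : ℝ, 0 < M → ∀ R : ℝ → ℝ, AH.IsPairsRate M R → ∀ δ : ℝ, 0 < δ → δ ≤ 1 / 2 →
      ∃ C : ℝ, 0 ≤ C ∧ ∀ᶠ T : ℝ in atTop, ∀ lam : ℝ, 0 < lam → lam ≤ 1 / 4 → ∀ L : ℤ,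
        |(∫ β in (2 * L - lam)..(2 * L + lam), montgomeryFormFactor β T) - 1| ≤
          C * (lam ^ 2 + lam * AH.errG M (R T) T lam L + 1 / (lam * Real.sqrt (Real.log T))) := by
  intro M hM R hR _ _ _
  obtain ⟨A, hA0, hA⟩ := exists_integral_formFactor_le hRH
  refine ⟨M * (A + 1) / 4, by positivity, ?_⟩
  filter_upwards [hA, eventually_gt_atTop (1 : ℝ)] with T hAT hT1 lam hlam hlam4 L
  have hI : ∫ β in (2 * (L : ℝ) - lam)..(2 * (L : ℝ) + lam), montgomeryFormFactor β T ≤ A :=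
    hAT _ _ (by linarith) (by linarith)
  have hI0 : 0 ≤ ∫ β in (2 * (L : ℝ) - lam)..(2 * (L : ℝ) + lam), montgomeryFormFactor β T :=
    intervalIntegral.integral_nonneg (by linarith) fun β _ ↦
      Montgomery.montgomeryFormFactor_nonneg β hT1
  have hX : |(∫ β in (2 * (L : ℝ) - lam)..(2 * (L : ℝ) + lam), montgomeryFormFactor β T) - 1| ≤
      A + 1 := by
    refine (abs_sub _ _).trans ?_
    rw [abs_of_nonneg hI0, abs_one]
    linarith
  have he : 1 / (lam ^ 2 * M) ≤ AH.errG M (R T) T lam L :=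
    one_div_le_errG hM (hR.1 T).le hT1.le lam (L : ℝ)
  have hs : 0 ≤ 1 / (lam * Real.sqrt (Real.log T)) := by positivity
  exact abs_le_of_errG_absorbs_sq hX hM hlam hlam4 he hs

open AH.Lem6AsTyped in
/-- **BGSTB 2025, Lemma 6 AS TYPED (`bgstb2025_lemma6`) — DISCHARGED** (conjuncts (i), (iii),
(iv)-right, (iv)-left of the typed claim, with RH and the AH-Pairs data as the antecedents INSIDE the
statement). (i) = `bgstb2025_lemma6_i` (seat t5, the printed route via Lemma 5 (i), (iv) and the
differencing (F-Hthm4)); (iii) = `bgstb2025_lemma6_iii_asTyped` (absorption: with `∃ C` after `M`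
the typed error `E_G(λ², K) ≥ 1/(λ⁴M)` dominates the RH-bounded left side — finding F-t2g4-1,
WEAK-AS-TYPED); (iv) = `bgstb2025_lemma6_iv` (seat t5, `F ≪ 1` near `±1` under RH). One constant
(the `max` of the three). HONEST READING: the printed Lemma 6 (iii) with absolute constants (rate
`O(λ)`) is NOT established here; its printed proof fails (E-ah-5,
`AH.bgstb2025_lemma6_printed_display_fails`), its statement is unrefuted, and the contentful sound
forms are `bgstb2025_lemma6_iii_lower_odd` / `_upper_odd` and `AH.window_odd_limit`.
[cite: BaluyotGoldstonSuriajayaTurnageButterbaugh2025, Lemma 6] -/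
theorem bgstb2025_lemma6_holds : bgstb2025_lemma6 := by
  intro hRH M hM R hR δ hδ hδ'
  obtain ⟨C₁, h₁⟩ := bgstb2025_lemma6_i hRH M hM R hR δ hδ hδ'
  obtain ⟨C₃, -, h₃⟩ := bgstb2025_lemma6_iii_asTyped hRH M hM R hR δ hδ hδ'
  obtain ⟨C₄, h₄⟩ := bgstb2025_lemma6_iv hRH
  refine ⟨max C₁ (max C₃ C₄), ?_⟩
  filter_upwards [h₁, h₃, h₄, eventually_gt_atTop (1 : ℝ)] with T h₁T h₃T h₄T hT1 lam hlam hlam4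
  have hC₁ : C₁ ≤ max C₁ (max C₃ C₄) := le_max_left _ _
  have hC₃ : C₃ ≤ max C₁ (max C₃ C₄) := le_max_of_le_right (le_max_left _ _)
  have hC₄ : C₄ ≤ max C₁ (max C₃ C₄) := le_max_of_le_right (le_max_right _ _)
  have hRT : 0 ≤ R T := (hR.1 T).le
  refine ⟨fun L ↦ ?_, fun K _ ↦ ?_, ?_, ?_⟩
  · refine (h₁T lam hlam hlam4 L).trans (mul_le_mul_of_nonneg_right hC₁ ?_)
    have := errG_nonneg hM.le hRT hT1.le lam (L : ℝ)
    positivity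
  · refine (h₃T lam hlam hlam4 K).trans (mul_le_mul_of_nonneg_right hC₃ ?_)
    have := errG_nonneg hM.le hRT hT1.le (lam ^ 2) (K : ℝ)
    positivity
  · exact (h₄T lam hlam hlam4).1.trans (mul_le_mul_of_nonneg_right hC₄ hlam.le)
  · exact (h₄T lam hlam hlam4).2.trans (mul_le_mul_of_nonneg_right hC₄ hlam.le)

open AH.Lem6AsTyped in
/-- **BGSTB 2025, Lemma 6 (v) AS TYPED (`bgstb2025_lemma6_v`) — DISCHARGED by absorption** (OURS,
finding F-t2g4-1, WEAK-AS-TYPED): with `∃ C` after `M`, the typed error `E_G(λ², K)/λ ≥ 1/(λ⁵M)`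
dominates the left side, which is at most `(A + 2(|P| + 1))/λ ≤ (A + 2(|P| + 1))/(256 λ⁵)` since
`0 ≤ G_λ(K) ≤ (1/λ) ∫_{K−λ}^{K+λ} F ≤ A/λ` (`G_λ ≥ 0`: `bgstb2025_lemma5_rh_holds`; the window bound
and `|P_0(T)| ≤ P` under RH); `C := M (A + 2(|P| + 1))/256`; the bound holds for every `K`, the
typed `Odd K` being unused. HONEST READING: the printed (v) with absolute constants is NOT established
(E-ah-5 stands; statement unrefuted). [cite: BaluyotGoldstonSuriajayaTurnageButterbaugh2025, Lemma 6 (v)] -/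
theorem bgstb2025_lemma6_v_holds : bgstb2025_lemma6_v := by
  intro hRH M hM R hR δ _ _
  obtain ⟨A, hA0, hA⟩ := exists_integral_formFactor_le hRH
  obtain ⟨P, hP⟩ := AH.Thm3.exists_abs_binDensity_le hRH M δ
  have hG0 := (bgstb2025_lemma5_rh_holds hRH).1
  refine ⟨M * (A + 2 * (|P| + 1)) / 256, ?_⟩
  filter_upwards [hA, hP, eventually_gt_atTop (1 : ℝ)] with T hAT hPT hT1 lam hlam hlam4 K _
  have hPd : |AH.binDensity 0 T M δ| ≤ |P| := hPT.trans (le_abs_self P)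
  have hGle : AH.heathBrownG lam K T ≤ A / lam := by
    rw [le_div_iff₀ hlam, mul_comm]
    exact (mul_heathBrownG_le_integral hlam hT1 (K : ℝ)).trans (hAT _ _ (by linarith) (by linarith))
  have hGnn : 0 ≤ AH.heathBrownG lam K T := hG0 lam K T hlam (by linarith) hT1
  have hB : 0 ≤ A + 2 * (|P| + 1) := by positivity
  have hX : |AH.heathBrownG lam K T - 2 * (AH.binDensity 0 T M δ - 1) / lam| ≤
      (A + 2 * (|P| + 1)) / lam := by
    refine (abs_sub _ _).trans ?_
    rw [abs_of_nonneg hGnn, abs_div, abs_of_pos hlam, abs_mul, abs_two, add_div]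
    have h := abs_sub (AH.binDensity 0 T M δ) 1
    rw [abs_one] at h
    have h2 : 2 * |AH.binDensity 0 T M δ - 1| / lam ≤ 2 * (|P| + 1) / lam := by
      gcongr
      linarith
    linarith
  have he : 1 / (lam ^ 4 * M) ≤ AH.errG M (R T) T (lam ^ 2) K := by
    have h := one_div_le_errG hM (hR.1 T).le hT1.le (lam ^ 2) (K : ℝ)
    rwa [show (lam ^ 2) ^ 2 = lam ^ 4 by ring] at h
  have hs : 0 ≤ 1 / (lam ^ 5 * Real.sqrt (Real.log T)) := by positivity
  exact abs_le_of_errG_absorbs_div hX hB hM hlam hlam4 he hs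

end Literature.NumberTheory.LFunctions

end
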